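import Summits.AtomisticToContinuum.BoseEinsteinCondensation.Theorems.BECThomsonPrincipleGDTransferDefs
import Literature.MathematicalPhysics.QuantumManyBody.PeriodicClusteringFromKyFanGap

/-!
# Route `BECThomsonPrinciple`, crux `GDTransfer` (stmt-AtomisticToContinuum-9482), line `dyson-dressed-witness`:
# stub `chordVariation`, part 2 — the mass and the energy form along lines of directions

Support file of `stub_chordVariation` (`GaussianDominationCan → TwoSidedDualNorm`).  Directions
(`IsDirection`: `C¹`, periodic, Bose-symmetric) are stable under `+`, `-` and scalars; their mass
`‖ζ‖² = mass L ζ` is finite; mass and energy form `𝓔 = eform v L` scale quadratically and satisfy the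
PARALLELOGRAM LAW along every line `ψ ± cζ` (from `lintegral_cellN_sq_add_add_sub`,
`lintegral_periodicEnergy_add_add_sub` of `PeriodicClusteringFromKyFanGap`); the crude triangle bound
`‖ψ ± tζ‖² ≤ (1 + t)‖ψ‖² + (t + t²)‖ζ‖²` (`t ≥ 0`); and the variational principle for directions
`E₀‖ζ‖² ≤ 𝓔(ζ)` (normalise with `PeriodicTrialState.ofFun`), i.e. the excess form
`q̃ = 𝓔 − E₀‖·‖²` is non-negative — whence, in real numbers, `q̃(a + b) ≤ 2q̃(a) + 2q̃(b)`
(`excess_add_le`).  These replace Cauchy–Schwarz for `q̃` in the symmetrised (`±t`) variational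
Kennedy–Lieb–Shastry argument of part 3.  All [folklore].
-/

noncomputable section

open MeasureTheory Filter
open scoped ENNReal NNReal ComplexConjugate

namespace Summit.AtomisticToContinuum.BoseEinsteinCondensation.Cruxes.GDTransfer.DysonDressedWitness

namespace ChordVariation

open Literature.MathematicalPhysics.QuantumManyBody.BoseGas

variable {m : ℕ} {L : ℝ}

/-! ## Directions form a module -/

/-- Directions are closed under addition. [folklore] -/
theorem dir_add {ζ ξ : Config (m + 1) → ℂ} (hζ : IsDirection m L ζ) (hξ : IsDirection m L ξ) :
    IsDirection m L (fun X => ζ X + ξ X) :=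
  ⟨hζ.contDiff.add hξ.contDiff, fun X i k => by simp only [hζ.periodic, hξ.periodic],
    fun σ X => by simp only [hζ.symm, hξ.symm]⟩

/-- Directions are closed under subtraction. [folklore] -/
theorem dir_sub {ζ ξ : Config (m + 1) → ℂ} (hζ : IsDirection m L ζ) (hξ : IsDirection m L ξ) :
    IsDirection m L (fun X => ζ X - ξ X) :=
  ⟨hζ.contDiff.sub hξ.contDiff, fun X i k => by simp only [hζ.periodic, hξ.periodic],
    fun σ X => by simp only [hζ.symm, hξ.symm]⟩

/-- Directions are closed under scalar multiplication. [folklore] -/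
theorem dir_const_mul {ζ : Config (m + 1) → ℂ} (hζ : IsDirection m L ζ) (c : ℂ) :
    IsDirection m L (fun X => c * ζ X) :=
  ⟨contDiff_const.mul hζ.contDiff, fun X i k => by simp only [hζ.periodic],
    fun σ X => by simp only [hζ.symm]⟩

/-! ## Mass and energy form: finiteness, scaling, parallelogram -/

/-- A continuous function has finite mass on the cell. [folklore] -/
theorem mass_ne_top_of_continuous {ζ : Config (m + 1) → ℂ} (hζ : Continuous ζ) :
    mass L ζ ≠ ⊤ := by
  have h := (integrableOn_cellN ((hζ.norm).pow 2) L).hasFiniteIntegral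
  rw [HasFiniteIntegral] at h
  refine ne_of_lt (lt_of_le_of_lt (le_of_eq (lintegral_congr fun X => ?_)) h)
  rw [coe_nnnorm_sq_eq_ofReal, Pi.pow_apply, Real.enorm_eq_ofReal (sq_nonneg _)]

/-- Scaling of the mass: `‖cζ‖² = |c|²‖ζ‖²`. [folklore] -/
theorem mass_smul (c : ℂ) (ζ : Config (m + 1) → ℂ) :
    mass L (fun X => c * ζ X) = (‖c‖₊ : ℝ≥0∞) ^ 2 * mass L ζ :=
  lintegral_cellN_sq_const_mul L c ζ

/-- Scaling of the energy form: `𝓔(cζ) = |c|²𝓔(ζ)`. [folklore] -/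
theorem eform_smul (v : ℝ → ℝ≥0∞) (c : ℂ) {ζ : Config (m + 1) → ℂ} (hζ : ContDiff ℝ 1 ζ) :
    eform v L (fun X => c * ζ X) = (‖c‖₊ : ℝ≥0∞) ^ 2 * eform v L ζ :=
  lintegral_periodicEnergy_const_mul v L c hζ

/-- A unimodular factor does not change the mass. [folklore] -/
theorem mass_smul_of_nnnorm_eq_one {c : ℂ} (hc : ‖c‖₊ = 1) (ζ : Config (m + 1) → ℂ) :
    mass L (fun X => c * ζ X) = mass L ζ := by
  rw [mass_smul, hc, ENNReal.coe_one, one_pow, one_mul]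

/-- A unimodular factor does not change the energy form. [folklore] -/
theorem eform_smul_of_nnnorm_eq_one (v : ℝ → ℝ≥0∞) {c : ℂ} (hc : ‖c‖₊ = 1)
    {ζ : Config (m + 1) → ℂ} (hζ : ContDiff ℝ 1 ζ) :
    eform v L (fun X => c * ζ X) = eform v L ζ := by
  rw [eform_smul v c hζ, hc, ENNReal.coe_one, one_pow, one_mul]

/-- **Parallelogram law for the mass along a line**:
`‖ψ + cζ‖² + ‖ψ − cζ‖² = 2‖ψ‖² + 2|c|²‖ζ‖²`. [folklore] -/
theorem mass_line_add_line {ψ ζ : Config (m + 1) → ℂ} (hψ : Continuous ψ)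
    (hζ : Continuous ζ) (c : ℂ) :
    mass L (fun X => ψ X + c * ζ X) + mass L (fun X => ψ X - c * ζ X) =
      2 * mass L ψ + 2 * ((‖c‖₊ : ℝ≥0∞) ^ 2 * mass L ζ) := by
  rw [← mass_smul c ζ]
  exact lintegral_cellN_sq_add_add_sub L hψ (continuous_const.mul hζ)

/-- **Parallelogram law for the energy form along a line**:
`𝓔(ψ + cζ) + 𝓔(ψ − cζ) = 2𝓔(ψ) + 2|c|²𝓔(ζ)` (all `v`, hard cores included). [folklore] -/
theorem eform_line_add_line {v : ℝ → ℝ≥0∞} (hv : Measurable v) {ψ ζ : Config (m + 1) → ℂ}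
    (hψ : ContDiff ℝ 1 ψ) (hζ : ContDiff ℝ 1 ζ) (c : ℂ) :
    eform v L (fun X => ψ X + c * ζ X) + eform v L (fun X => ψ X - c * ζ X) =
      2 * eform v L ψ + 2 * ((‖c‖₊ : ℝ≥0∞) ^ 2 * eform v L ζ) := by
  rw [← eform_smul v c hζ]
  exact lintegral_periodicEnergy_add_add_sub hv L hψ (contDiff_const.mul hζ)

/-- Parallelogram law for the mass of a sum and a difference. [folklore] -/
theorem mass_add_add_sub {a b : Config (m + 1) → ℂ} (ha : Continuous a) (hb : Continuous b) :
    mass L (fun X => a X + b X) + mass L (fun X => a X - b X) = 2 * mass L a + 2 * mass L b :=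
  lintegral_cellN_sq_add_add_sub L ha hb

/-- Parallelogram law for the energy form of a sum and a difference. [folklore] -/
theorem eform_add_add_sub {v : ℝ → ℝ≥0∞} (hv : Measurable v) {a b : Config (m + 1) → ℂ}
    (ha : ContDiff ℝ 1 a) (hb : ContDiff ℝ 1 b) :
    eform v L (fun X => a X + b X) + eform v L (fun X => a X - b X) =
      2 * eform v L a + 2 * eform v L b :=
  lintegral_periodicEnergy_add_add_sub hv L ha hb

/-! ## The crude triangle bound for the mass along a real line -/

/-- `|a ± b|² ≤ (1 + t)|a|² + (t + t²)|z|²` whenever `|b| ≤ t|z|`, `t ≥ 0` (read in `ℝ≥0∞`). [folklore] -/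
theorem ennreal_sq_nnnorm_le_of_norm_le {a b z : ℂ} {t : ℝ} (ht : 0 ≤ t) (hb : ‖b‖ ≤ t * ‖z‖)
    (w : ℂ) (hw : ‖w‖ ≤ ‖a‖ + ‖b‖) :
    ((‖w‖₊ : ℝ≥0∞)) ^ 2 ≤
      ENNReal.ofReal (1 + t) * ((‖a‖₊ : ℝ≥0∞)) ^ 2 +
        ENNReal.ofReal (t + t ^ 2) * ((‖z‖₊ : ℝ≥0∞)) ^ 2 := by
  have ha0 : 0 ≤ ‖a‖ := norm_nonneg a
  have hz0 : 0 ≤ ‖z‖ := norm_nonneg z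
  have hw0 : 0 ≤ ‖w‖ := norm_nonneg w
  have h1 : ‖w‖ ≤ ‖a‖ + t * ‖z‖ := hw.trans (by linarith)
  have hreal : ‖w‖ ^ 2 ≤ (1 + t) * ‖a‖ ^ 2 + (t + t ^ 2) * ‖z‖ ^ 2 := by
    have h2 : ‖w‖ ^ 2 ≤ (‖a‖ + t * ‖z‖) ^ 2 := pow_le_pow_left₀ hw0 h1 2
    nlinarith [sq_nonneg (‖a‖ - ‖z‖), mul_nonneg ht ha0, mul_nonneg ht hz0,
      mul_nonneg ht (sq_nonneg (‖a‖ - ‖z‖))]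
  rw [coe_nnnorm_sq_eq_ofReal, coe_nnnorm_sq_eq_ofReal, coe_nnnorm_sq_eq_ofReal,
    ← ENNReal.ofReal_mul (by linarith), ← ENNReal.ofReal_mul (by positivity),
    ← ENNReal.ofReal_add (by positivity) (by positivity)]
  exact ENNReal.ofReal_le_ofReal hreal

/-- **`‖ψ + tζ‖² ≤ (1 + t)‖ψ‖² + (t + t²)‖ζ‖²`** for `t ≥ 0`. [folklore] -/
theorem mass_line_le {ψ ζ : Config (m + 1) → ℂ} (hψ : Continuous ψ) (hζ : Continuous ζ) {t : ℝ}
    (ht : 0 ≤ t) :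
    mass L (fun X => ψ X + (t : ℂ) * ζ X) ≤
      ENNReal.ofReal (1 + t) * mass L ψ + ENNReal.ofReal (t + t ^ 2) * mass L ζ := by
  unfold mass
  rw [← lintegral_const_mul _ (measurable_coe_nnnorm_sq hψ),
    ← lintegral_const_mul _ (measurable_coe_nnnorm_sq hζ),
    ← lintegral_add_left ((measurable_coe_nnnorm_sq hψ).const_mul _)]
  refine lintegral_mono fun X => ?_
  have hb : ‖(t : ℂ) * ζ X‖ ≤ t * ‖ζ X‖ := by
    rw [norm_mul, Complex.norm_real, Real.norm_of_nonneg ht]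
  exact ennreal_sq_nnnorm_le_of_norm_le ht hb _ (norm_add_le _ _)

/-- **`‖ψ − tζ‖² ≤ (1 + t)‖ψ‖² + (t + t²)‖ζ‖²`** for `t ≥ 0`. [folklore] -/
theorem mass_line_le_neg {ψ ζ : Config (m + 1) → ℂ} (hψ : Continuous ψ) (hζ : Continuous ζ)
    {t : ℝ} (ht : 0 ≤ t) :
    mass L (fun X => ψ X - (t : ℂ) * ζ X) ≤
      ENNReal.ofReal (1 + t) * mass L ψ + ENNReal.ofReal (t + t ^ 2) * mass L ζ := by
  unfold mass
  rw [← lintegral_const_mul _ (measurable_coe_nnnorm_sq hψ),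
    ← lintegral_const_mul _ (measurable_coe_nnnorm_sq hζ),
    ← lintegral_add_left ((measurable_coe_nnnorm_sq hψ).const_mul _)]
  refine lintegral_mono fun X => ?_
  have hb : ‖(t : ℂ) * ζ X‖ ≤ t * ‖ζ X‖ := by
    rw [norm_mul, Complex.norm_real, Real.norm_of_nonneg ht]
  exact ennreal_sq_nnnorm_le_of_norm_le ht hb _ (norm_sub_le _ _)

/-! ## The variational principle for directions (`q̃ ≥ 0`) -/

/-- **`E₀‖ζ‖² ≤ 𝓔(ζ)`** for every direction `ζ` (normalise `ζ` and use the variational principle;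
trivial for `‖ζ‖ = 0`). [folklore] -/
theorem e0_mul_mass_le_eform (v : ℝ → ℝ≥0∞) {ζ : Config (m + 1) → ℂ} (hζ : IsDirection m L ζ) :
    periodicGroundStateEnergy v (m + 1) L * mass L ζ ≤ eform v L ζ := by
  -- adapted from the lead's toolkit lemma `IsDirection.groundStateEnergy_mul_mass_le`
  by_cases h0 : mass L ζ = 0
  · simp [h0]
  have htop : mass L ζ ≠ ⊤ := mass_ne_top_of_continuous hζ.contDiff.continuous
  set Ψ : PeriodicTrialState (m + 1) L :=
    PeriodicTrialState.ofFun ζ hζ.contDiff hζ.periodic hζ.symm h0 htop with hΨdef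
  set a : ℂ := ((Real.sqrt (mass L ζ).toReal)⁻¹ : ℂ) with ha_def
  have hΨ : Ψ.ψ = fun X => a * ζ X := rfl
  have hIpos : 0 < (mass L ζ).toReal := ENNReal.toReal_pos h0 htop
  have ha : (‖a‖₊ : ℝ≥0∞) ^ 2 = (mass L ζ)⁻¹ := by
    rw [coe_nnnorm_sq_eq_ofReal, ha_def, norm_inv, Complex.norm_real,
      Real.norm_of_nonneg (Real.sqrt_nonneg _), inv_pow, Real.sq_sqrt hIpos.le,
      ENNReal.ofReal_inv_of_pos hIpos, ENNReal.ofReal_toReal htop]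
  have h1 : periodicGroundStateEnergy v (m + 1) L ≤ (mass L ζ)⁻¹ * eform v L ζ := by
    calc periodicGroundStateEnergy v (m + 1) L ≤ periodicEnergy v Ψ := periodicGroundStateEnergy_le v Ψ
      _ = eform v L Ψ.ψ := (eform_trialState v Ψ).symm
      _ = (‖a‖₊ : ℝ≥0∞) ^ 2 * eform v L ζ := by rw [hΨ]; exact eform_smul v a hζ.contDiff
      _ = (mass L ζ)⁻¹ * eform v L ζ := by rw [ha]
  calc periodicGroundStateEnergy v (m + 1) L * mass L ζ
      ≤ (mass L ζ)⁻¹ * eform v L ζ * mass L ζ := by gcongr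
    _ = eform v L ζ := by
        rw [mul_comm ((mass L ζ)⁻¹) _, mul_assoc, ENNReal.inv_mul_cancel h0 htop, mul_one]

/-- Real form of `q̃ ≥ 0`: `E₀ · ‖ζ‖² ≤ 𝓔(ζ)` in `ℝ` for a direction of finite energy form. [folklore] -/
theorem e0_mul_mass_le_eform_toReal (v : ℝ → ℝ≥0∞) {ζ : Config (m + 1) → ℂ} (hζ : IsDirection m L ζ)
    (hfin : eform v L ζ ≠ ⊤) :
    (periodicGroundStateEnergy v (m + 1) L).toReal * (mass L ζ).toReal ≤ (eform v L ζ).toReal := by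
  rw [← ENNReal.toReal_mul]
  exact ENNReal.toReal_mono hfin (e0_mul_mass_le_eform v hζ)

/-! ## The excess form of a sum: `q̃(a + b) ≤ 2q̃(a) + 2q̃(b)` -/

/-- **Sum of two directions**: finite energy form, `‖a + b‖² ≤ 2‖a‖² + 2‖b‖²`, and
`q̃(a + b) ≤ 2q̃(a) + 2q̃(b)` for the excess form `q̃ = 𝓔 − E₀‖·‖²` (parallelogram law and
`q̃(a − b) ≥ 0`), in real numbers. [folklore] -/
theorem excess_add_le {v : ℝ → ℝ≥0∞} (hv : Measurable v) {a b : Config (m + 1) → ℂ}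
    (ha : IsDirection m L a) (hb : IsDirection m L b) (hea : eform v L a ≠ ⊤)
    (heb : eform v L b ≠ ⊤) :
    eform v L (fun X => a X + b X) ≠ ⊤ ∧
    (mass L (fun X => a X + b X)).toReal ≤ 2 * (mass L a).toReal + 2 * (mass L b).toReal ∧
    (eform v L (fun X => a X + b X)).toReal -
        (periodicGroundStateEnergy v (m + 1) L).toReal * (mass L (fun X => a X + b X)).toReal ≤
      2 * ((eform v L a).toReal - (periodicGroundStateEnergy v (m + 1) L).toReal * (mass L a).toReal) +
        2 * ((eform v L b).toReal -
          (periodicGroundStateEnergy v (m + 1) L).toReal * (mass L b).toReal) := by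
  have hpe := eform_add_add_sub (L := L) hv ha.contDiff hb.contDiff
  have hpm := mass_add_add_sub (L := L) ha.contDiff.continuous hb.contDiff.continuous
  have hrhs : 2 * eform v L a + 2 * eform v L b ≠ ⊤ :=
    ENNReal.add_ne_top.2 ⟨ENNReal.mul_ne_top ENNReal.ofNat_ne_top hea,
      ENNReal.mul_ne_top ENNReal.ofNat_ne_top heb⟩
  have hes : eform v L (fun X => a X + b X) ≠ ⊤ :=
    ne_top_of_le_ne_top hrhs (hpe ▸ le_self_add)
  have hed : eform v L (fun X => a X - b X) ≠ ⊤ :=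
    ne_top_of_le_ne_top hrhs (hpe ▸ le_add_self)
  have hma := mass_ne_top_of_continuous (L := L) ha.contDiff.continuous
  have hmb := mass_ne_top_of_continuous (L := L) hb.contDiff.continuous
  have hms := mass_ne_top_of_continuous (L := L) (ζ := fun X => a X + b X)
    (ha.contDiff.continuous.add hb.contDiff.continuous)
  have hmd := mass_ne_top_of_continuous (L := L) (ζ := fun X => a X - b X)
    (ha.contDiff.continuous.sub hb.contDiff.continuous)
  -- real forms of the two parallelogram laws
  have hpe' := congrArg ENNReal.toReal hpe
  rw [ENNReal.toReal_add hes hed, ENNReal.toReal_add (ENNReal.mul_ne_top ENNReal.ofNat_ne_top hea)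
    (ENNReal.mul_ne_top ENNReal.ofNat_ne_top heb), ENNReal.toReal_mul, ENNReal.toReal_mul,
    ENNReal.toReal_ofNat] at hpe'
  have hpm' := congrArg ENNReal.toReal hpm
  rw [ENNReal.toReal_add hms hmd, ENNReal.toReal_add (ENNReal.mul_ne_top ENNReal.ofNat_ne_top hma)
    (ENNReal.mul_ne_top ENNReal.ofNat_ne_top hmb), ENNReal.toReal_mul, ENNReal.toReal_mul,
    ENNReal.toReal_ofNat] at hpm'
  -- `q̃(a - b) ≥ 0`
  have hqd := e0_mul_mass_le_eform_toReal v (dir_sub ha hb) hed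
  have hmd0 : 0 ≤ (mass L (fun X => a X - b X)).toReal := ENNReal.toReal_nonneg
  set e₀ := (periodicGroundStateEnergy v (m + 1) L).toReal with he₀
  have key : e₀ * (mass L (fun X => a X + b X)).toReal =
      2 * (e₀ * (mass L a).toReal) + 2 * (e₀ * (mass L b).toReal) -
        e₀ * (mass L (fun X => a X - b X)).toReal := by
    have hms_eq : (mass L (fun X => a X + b X)).toReal =
        2 * (mass L a).toReal + 2 * (mass L b).toReal - (mass L (fun X => a X - b X)).toReal := by
      linarith [hpm']
    rw [hms_eq]
    ring
  refine ⟨hes, ?_, ?_⟩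
  · linarith
  · linarith [hqd, hpe', key]

end ChordVariation

/-- **Part 2 of `stub_chordVariation` (registered helper statement)**: the variational principle for
directions, `E₀‖ζ‖² ≤ 𝓔(ζ)` (`q̃ ≥ 0`). [folklore] -/
theorem chordVariation_e0_mul_mass_le_eform :
    ∀ (m : ℕ) (L : ℝ) (v : ℝ → ENNReal)
      (ζ : Literature.MathematicalPhysics.QuantumManyBody.BoseGas.Config (m + 1) → ℂ),
      IsDirection m L ζ →
        Literature.MathematicalPhysics.QuantumManyBody.BoseGas.periodicGroundStateEnergy v (m + 1) L *
            mass L ζ ≤ eform v L ζ :=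
  fun _ _ v _ hζ => ChordVariation.e0_mul_mass_le_eform v hζ

end Summit.AtomisticToContinuum.BoseEinsteinCondensation.Cruxes.GDTransfer.DysonDressedWitness

end
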